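import Summits.QuantumFields.YangMills.Theorems.BalabanUVNodesN15CovariantAveragingTwoGridAdjoint
import HarnessLib

/-!
# Route «BalabanUVNodes», node N15 = NE2, road (c) — PROGRAMME (P-Q), VI: THE TWO-GRID η-DEFECT OF THE AVERAGING PERTURBATION `N_V^Q = a(Q*Q ⊗ 1 − Q*(U)Q(U))` — Leibniz over
# the two products, the four shape defects of n15-c∕184a∕184b (the flat pair is the case `T ≡ 1`, fit `0`, size `1`), the one-grid letters of n15-c∕182b:
# `𝔇_{P̂}(N_V^Q′, N_V^Q) ≤ |a|·c_{d+1}(δ)e^{3δ}·[4η + (φ + 2Bη)(2 + K + K′)]·e^{−δd}`, `η = L^{−k}` — an η-RATE letter once the kernel fit `φ` is `O(η)` (n15-c∕185c)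

Cell `pub-ymgap`, seat `pub-ymgap-dag-n15-c` (generation g21; R134 (a) seat, strategy s1; HUMAN RULING D-0062; chair R424 venue).  `bears_on: R4∕N15 · K3⁸ SpineGivenEndpointR13SepCoPHV
(stmt-QuantumFields-27366)`; filed `--supports stmt-QuantumFields-27366 --as helper` — COUNT-NEUTRAL.  THEOREMS only ([folklore] block-majorant bookkeeping), 0 `def`, 0 `sorry`.  Imports BY NAME,
nothing in the tree modified ∕ restated: n15-c∕184b (through it 184a ★★ `hasMaj_qvKer_twoGrid`, 184b ★★ `hasMaj_qvAdjKer_twoGrid`, 182b `hasMaj_qvCov`∕`hasMaj_qvCovAdj`∕`cva_tensorId_comp`, 181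
`qvCov`∕`qvCovAdj`∕`qvCov_one`∕`qvCovAdj_one`∕`cvaPath_one`, 182a `rows_one`), the Literature's `T4EtaRateDefect.idef`∕`idef_comp`∕`idef_sub`∕`idef_smul`, `B11SectG.hasMaj_comp_exp`, `rowSum_unitTorusGeo`.

WHY.  FILE 123's two-grid row `hDNV` for the cover knit with Bałaban's covariant averaging summand live (n15-c∕183) is the η-defect `N_V^Q′∘P̂ − P̂∘N_V^Q` through King's prolongation
`P̂ = pull (liftMap π̂ ι)`.  By `idef_comp` (both grids share the unit lattice, `τ₂ = id` there): `𝔇(X′*X′, X*X) = X′*∘(X′P̂ − X) + (X′* − P̂X*)∘X` for the flat pair `X = Q₁` and the covariant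
pair `X = Q_T`; the four inner defects are n15-c∕184a∕184b (`≤ (φ + 2B∕L^k)e^{ρ′}e^{−ρ′d}`; for the flat pair `φ = 0`, `B = 1`), the outer factors n15-c∕182b (`Q*_{T′} ≤ (1+K′)e^{ρ′}e^{−ρ′d}`,
`Q_T ≤ (1+K)…`); compositions through the unit lattice by `hasMaj_comp_exp` (Lemma 2.1's row sum `c_{d+1}(δ)`).

RESULTS ([folklore]).
* §1 `idef_pull_id_eq` ∕ `idef_id_pull_eq` (the inner defects ARE 184a's ∕ 184b's operators), `hasMaj_twoGrid_flat` ∕ `hasMaj_twoGrid_flatAdj` (the flat pair: fit `0`, size `1`).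
* §2 ★★ **`hasMaj_idef_nvQ`** — for a coarse transporter datum `T` (level `L^k`) and a fine one `T′` (level `L^mL^k`) with rows∕columns `ρ`-∕`ρ′`-close to `1`, sizes `K = (1+ρ)^{(d+2)L^k} − 1`,
  `K′ = (1+ρ′)^{(d+2)L^mL^k} − 1`, and the two-grid kernel fits `φ` of 184a∕184b (rows and columns): `idef P̂ P̂ (N_V^Q′) (N_V^Q) ≤ |a|·c_{d+1}(δ)·e^{3δ}·(4∕L^k + (φ + 2(1+K)∕L^k)·(2 + K + K′))·e^{−δ|y−y′|_T}`
  from coarse coloured 1-forms (unit blocks) into fine ones (unit blocks), every `δ > 0`.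

HONEST FRAMING ∕ LIMITS.  Generic bookkeeping for the MODEL objects of n15-c∕181 (main term (125); abstract transporter data); the fits `φ`, `ρ`, `ρ′` are HYPOTHESES (produced at the cover by
n15-c∕185a–c from FILE 130's small-field letters — the sequel); no estimate of Bałaban's.  NE2⁺ NOT PRINTED; N15 of record untouched (DISCHARGED AS CONSUMED); counts UNMOVED (typed 28∕28); one
finite 𝕋⁴ at fixed ε per index — NOT infinite volume ∕ OS ∕ mass gap ∕ Clay.  Restate-immune (no Theses import).
-/

noncomputable section

open scoped BigOperators Matrix
open Finset

namespace Summit.QuantumFields.YangMills.BalabanUVNodes.N15.CovAvg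

open Literature.MathematicalPhysics.QuantumFieldTheory.Balaban1983to89
open Literature.MathematicalPhysics.QuantumFieldTheory.Balaban1983to89.B11SectG (BlockNorm HasMaj RowSum hasMaj_comp_exp)
open Literature.MathematicalPhysics.QuantumFieldTheory.Balaban1983to89.B5Prop11Plancherel (Tor fine unitVec)
open Literature.MathematicalPhysics.QuantumFieldTheory.Balaban1983to89.B6UnitTorusCarrier (unitTorusGeo triangle254_unitTorusGeo rowSum_unitTorusGeo unitTorusGeo_dist_nonneg unitTorusGeo_dist)
open Literature.MathematicalPhysics.QuantumFieldTheory.Balaban1983to89.T4EtaRateDefect (idef idef_comp idef_sub idef_smul)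
open Literature.MathematicalPhysics.QuantumFieldTheory.Balaban1983to89.T4EtaRateCoeffDefect (pull pull_apply)
open Literature.MathematicalPhysics.QuantumFieldTheory.King1986.Torus (blockOf tdistT tdistT_nonneg)
open Summit.QuantumFields.YangMills.BalabanUVNodes.N15.VectorPiece (kingPr kingPrV tensorId)
open Summit.QuantumFields.YangMills.BalabanUVNodes.N15.MatrixSpecies (liftMap liftBlk)
open Summit.QuantumFields.YangMills.BalabanUVNodes.N15.TwoGrid (qvRe qvAdjRe hasMaj_smul_ofBlocks)

variable {d : ℕ}

/-! ## §1 The inner defects are the shape defects; the flat pair -/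

section Inner

variable {L : ℕ} [NeZero L] (M : Fin (d + 1) → ℕ) [∀ μ, NeZero (M μ)] (k m : ℕ) {ι : Type} [Fintype ι] [DecidableEq ι]

omit [NeZero L] [∀ μ, NeZero (M μ)] [Fintype ι] [DecidableEq ι] in
/-- `idef P̂ id X′ X = X′∘P̂ − X` (the average-shape defect of n15-c∕184a). [folklore] -/
theorem idef_pull_id_eq (X' : ((Tor (fine (L ^ m * L ^ k) M) × Fin (d + 1)) × ι → ℝ) →ₗ[ℝ] ((Tor M × Fin (d + 1)) × ι → ℝ))
    (X : ((Tor (fine (L ^ k) M) × Fin (d + 1)) × ι → ℝ) →ₗ[ℝ] ((Tor M × Fin (d + 1)) × ι → ℝ)) :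
    idef (pull (liftMap (kingPrV L k m M) ι)) LinearMap.id X' X = X' ∘ₗ pull (liftMap (kingPrV L k m M) ι) - X := by
  rw [idef, LinearMap.id_comp]

omit [NeZero L] [∀ μ, NeZero (M μ)] [Fintype ι] [DecidableEq ι] in
/-- `idef id P̂ Y′ Y = Y′ − P̂∘Y` (the adjoint-shape defect of n15-c∕184b). [folklore] -/
theorem idef_id_pull_eq (Y' : ((Tor M × Fin (d + 1)) × ι → ℝ) →ₗ[ℝ] ((Tor (fine (L ^ m * L ^ k) M) × Fin (d + 1)) × ι → ℝ))
    (Y : ((Tor M × Fin (d + 1)) × ι → ℝ) →ₗ[ℝ] ((Tor (fine (L ^ k) M) × Fin (d + 1)) × ι → ℝ)) :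
    idef LinearMap.id (pull (liftMap (kingPrV L k m M) ι)) Y' Y = Y' - pull (liftMap (kingPrV L k m M) ι) ∘ₗ Y := by
  rw [idef, LinearMap.comp_id]

/-- THE FLAT AVERAGE PAIR THROUGH THE PAIRING: `Q₁′∘P̂ − Q₁ ≤ (2∕L^k)·e^{ρ′}·e^{−ρ′d}` (184a at `W ≡ W′ ≡ 1`: fit `0`, size `1`). [cite: King1986, Prop. 3.9 (3.73) p.665 (shape)] -/
theorem hasMaj_twoGrid_flat {ρ' : ℝ} (hρ' : 0 ≤ ρ') :
    HasMaj (BlockNorm.ofBlocks (unitTorusGeo L k M) (liftBlk (fun b : Tor (fine (L ^ k) M) × Fin (d + 1) => blockOf (L ^ k) M b.1) ι))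
      (BlockNorm.ofBlocks (unitTorusGeo L k M) (liftBlk (fun b : Tor M × Fin (d + 1) => b.1) ι))
      (qvCov M (L ^ m * L ^ k) (fun _ _ => (1 : Matrix ι ι ℝ)) ∘ₗ pull (liftMap (kingPrV L k m M) ι) - qvCov M (L ^ k) (fun _ _ => (1 : Matrix ι ι ℝ)))
      (fun y y' => 2 / (L ^ k : ℕ) * Real.exp ρ' * Real.exp (-(ρ' * tdistT M y y'))) := by
  rw [qvCov, qvCov]
  refine (hasMaj_qvKer_twoGrid M k m zero_le_one le_rfl hρ' (fun p s _ i => ?_) (fun x' μ s j δ _ _ _ _ i => ?_)).mono fun y y' => le_of_eq (by ring)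
  · rw [cvaPath_one]; exact (rows_one i).le
  · simp only [cvaPath_one, sub_self, Matrix.zero_apply, abs_zero, sum_const_zero]; exact le_rfl

/-- THE FLAT ADJOINT PAIR: `Q₁′* − P̂∘Q₁* ≤ (2∕L^k)·e^{ρ′}·e^{−ρ′d}` (184b at `W ≡ W′ ≡ 1`). [cite: King1986, Prop. 3.9 (3.73) p.665 (shape)] -/
theorem hasMaj_twoGrid_flatAdj {ρ' : ℝ} (hρ' : 0 ≤ ρ') :
    HasMaj (BlockNorm.ofBlocks (unitTorusGeo L k M) (liftBlk (fun b : Tor M × Fin (d + 1) => b.1) ι))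
      (BlockNorm.ofBlocks (unitTorusGeo L k M) (liftBlk (fun b : Tor (fine (L ^ m * L ^ k) M) × Fin (d + 1) => blockOf (L ^ m * L ^ k) M b.1) ι))
      (qvCovAdj M (L ^ m * L ^ k) (fun _ _ => (1 : Matrix ι ι ℝ)) - pull (liftMap (kingPrV L k m M) ι) ∘ₗ qvCovAdj M (L ^ k) (fun _ _ => (1 : Matrix ι ι ℝ)))
      (fun y y' => 2 / (L ^ k : ℕ) * Real.exp ρ' * Real.exp (-(ρ' * tdistT M y y'))) := by
  rw [qvCovAdj, qvCovAdj]
  refine (hasMaj_qvAdjKer_twoGrid M k m zero_le_one le_rfl hρ' (fun p s _ c => ?_) (fun x' κ s j δ _ _ _ _ c => ?_)).mono fun y y' => le_of_eq (by ring)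
  · rw [cvaPath_one, cols_eq_rows_transpose, Matrix.transpose_one]; exact (rows_one c).le
  · simp only [cvaPath_one, sub_self, Matrix.zero_apply, abs_zero, sum_const_zero]; exact le_rfl

end Inner

/-! ## §2 The two-grid η-defect of `N_V^Q` -/

section Defect

variable {L : ℕ} [NeZero L] (M : Fin (d + 1) → ℕ) [∀ μ, NeZero (M μ)] (k m : ℕ) {ι : Type} [Fintype ι] [DecidableEq ι]

/-- ★★ **THE TWO-GRID η-DEFECT OF THE AVERAGING PERTURBATION.**  Coarse transporters `T` (level `L^k`) with rows and columns `ρ`-close to `1`, fine `T′` (level `L^mL^k`) with columns `ρ′`-close to `1`, and the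
two-grid kernel fits of n15-c∕184a∕184b for `(cvaPath T′, cvaPath T)` in rows and columns (`φ`); `δ > 0`.  Then, with `K = (1+ρ)^{(d+2)L^k} − 1`, `K′ = (1+ρ′)^{(d+2)L^mL^k} − 1`,
`idef P̂ P̂ (a·(Q′*Q′ ⊗ 1 − Q*_{T′}Q_{T′})) (a·(Q*Q ⊗ 1 − Q*_TQ_T)) ≤ |a|·c_{d+1}(δ)·e^{3δ}·(4∕L^k + (φ + 2(1+K)∕L^k)·(2 + K + K′))·e^{−δ|y−y′|_T}` from coarse coloured 1-forms into fine ones.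
[cite: King1986, Prop. 3.9 (3.73) p.665 (shape of the η-rate); Balaban1985BackgroundPropagators, (3.59)–(3.60) p.402 (the averaging words)] -/
theorem hasMaj_idef_nvQ {T : Fin (d + 1) → Tor (fine (L ^ k) M) × Fin (d + 1) → Matrix ι ι ℝ} {T' : Fin (d + 1) → Tor (fine (L ^ m * L ^ k) M) × Fin (d + 1) → Matrix ι ι ℝ}
    {ρ ρ₁ φ δ : ℝ} (hρ : 0 ≤ ρ) (hρ₁ : 0 ≤ ρ₁) (hφ : 0 ≤ φ) (hδ : 0 < δ)
    (hTr : ∀ μ p i, ∑ j, |(T μ p - 1) i j| ≤ ρ) (hTc : ∀ μ p j, ∑ i, |(T μ p - 1) i j| ≤ ρ)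
    (hTc' : ∀ μ p j, ∑ i, |(T' μ p - 1) i j| ≤ ρ₁)
    (hfit : ∀ (x' : Tor (fine (L ^ m * L ^ k) M)) (μ : Fin (d + 1)) (s j δ' : ℕ), s < L ^ k → j < L ^ m → δ' ≤ 1 →
      kingPr L k m M (x' + j • unitVec (fine (L ^ m * L ^ k) M) μ) = kingPr L k m M x' + δ' • unitVec (fine (L ^ k) M) μ →
      ∀ i, ∑ c, |(cvaPath M (L ^ m * L ^ k) T' (x', μ) (L ^ m * s + j) - cvaPath M (L ^ k) T (kingPr L k m M x', μ) (s + δ')) i c| ≤ φ)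
    (hfitA : ∀ (x' : Tor (fine (L ^ m * L ^ k) M)) (κ : Fin (d + 1)) (s j δ' : ℕ), s < L ^ k → j < L ^ m → δ' ≤ 1 →
      kingPr L k m M (x' - j • unitVec (fine (L ^ m * L ^ k) M) κ) = kingPr L k m M x' - δ' • unitVec (fine (L ^ k) M) κ →
      ∀ c, ∑ i, |(cvaPath M (L ^ m * L ^ k) T' (x' - (L ^ m * s + j) • unitVec (fine (L ^ m * L ^ k) M) κ, κ) (L ^ m * s + j) -
        cvaPath M (L ^ k) T (kingPr L k m M x' - (s + δ') • unitVec (fine (L ^ k) M) κ, κ) (s + δ')) i c| ≤ φ) (a : ℝ) :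
    HasMaj (BlockNorm.ofBlocks (unitTorusGeo L k M) (liftBlk (fun b : Tor (fine (L ^ k) M) × Fin (d + 1) => blockOf (L ^ k) M b.1) ι))
      (BlockNorm.ofBlocks (unitTorusGeo L k M) (liftBlk (fun b : Tor (fine (L ^ m * L ^ k) M) × Fin (d + 1) => blockOf (L ^ m * L ^ k) M b.1) ι))
      (idef (pull (liftMap (kingPrV L k m M) ι)) (pull (liftMap (kingPrV L k m M) ι))
        (a • (tensorId ι (qvAdjRe M (L ^ m * L ^ k) ∘ₗ qvRe M (L ^ m * L ^ k)) - qvCovAdj M (L ^ m * L ^ k) T' ∘ₗ qvCov M (L ^ m * L ^ k) T'))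
        (a • (tensorId ι (qvAdjRe M (L ^ k) ∘ₗ qvRe M (L ^ k)) - qvCovAdj M (L ^ k) T ∘ₗ qvCov M (L ^ k) T)))
      (fun y y' => |a| * (B4Sect5Proof.latticeConst (d + 1) δ * Real.exp (3 * δ)) *
        (4 / (L ^ k : ℕ) + (φ + 2 * ((1 + ρ) ^ ((d + 2) * L ^ k)) / (L ^ k : ℕ)) * (2 + ((1 + ρ) ^ ((d + 2) * L ^ k) - 1) + ((1 + ρ₁) ^ ((d + 2) * (L ^ m * L ^ k)) - 1))) *
        Real.exp (-(δ * tdistT M y y'))) := by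
  -- constants
  set K : ℝ := (1 + ρ) ^ ((d + 2) * L ^ k) - 1 with hKdef
  set K' : ℝ := (1 + ρ₁) ^ ((d + 2) * (L ^ m * L ^ k)) - 1 with hK'def
  set c : ℝ := B4Sect5Proof.latticeConst (d + 1) δ with hcdef
  have hK : 0 ≤ K := by have := one_le_pow₀ (M₀ := ℝ) (a := 1 + ρ) (by linarith) (n := (d + 2) * L ^ k); rw [hKdef]; linarith
  have hK' : 0 ≤ K' := by have := one_le_pow₀ (M₀ := ℝ) (a := 1 + ρ₁) (by linarith) (n := (d + 2) * (L ^ m * L ^ k)); rw [hK'def]; linarith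
  have hc : 0 ≤ c := B4Sect5Proof.latticeConst_nonneg (d + 1) hδ.le
  have hrow : RowSum (unitTorusGeo L k M) δ c := rowSum_unitTorusGeo L k M hδ
  have h2δ : (0 : ℝ) ≤ 2 * δ := by linarith
  have hn0 : (0 : ℝ) ≤ 2 / (L ^ k : ℕ) := by positivity
  have hB : 0 ≤ φ + 2 * (1 + K) / (L ^ k : ℕ) := by positivity
  have h1K : (1 + ρ) ^ ((d + 2) * L ^ k) = 1 + K := by rw [hKdef]; ring
  have h1K' : (1 + ρ₁) ^ ((d + 2) * (L ^ m * L ^ k)) = 1 + K' := by rw [hK'def]; ring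
  -- the flat pair is the covariant pair at `T ≡ 1`
  have hflat : ∀ (n : ℕ) [NeZero n], tensorId ι (qvAdjRe M n ∘ₗ qvRe M n) = qvCovAdj M n (fun _ _ => (1 : Matrix ι ι ℝ)) ∘ₗ qvCov M n (fun _ _ => (1 : Matrix ι ι ℝ)) :=
    fun n _ => by rw [cva_tensorId_comp, qvCov_one, qvCovAdj_one]
  rw [hflat (L ^ k), hflat (L ^ m * L ^ k), idef_smul, idef_sub,
    idef_comp (τ₂ := (LinearMap.id : ((Tor M × Fin (d + 1)) × ι → ℝ) →ₗ[ℝ] ((Tor M × Fin (d + 1)) × ι → ℝ))),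
    idef_comp (τ₂ := (LinearMap.id : ((Tor M × Fin (d + 1)) × ι → ℝ) →ₗ[ℝ] ((Tor M × Fin (d + 1)) × ι → ℝ))),
    idef_pull_id_eq, idef_pull_id_eq, idef_id_pull_eq, idef_id_pull_eq]
  -- the four inner defects and the four outer factors
  have hD1 := hasMaj_twoGrid_flat (L := L) M k m (ι := ι) hδ.le
  have hD2 := hasMaj_twoGrid_flatAdj (L := L) M k m (ι := ι) h2δ
  have hD3 : HasMaj (BlockNorm.ofBlocks (unitTorusGeo L k M) (liftBlk (fun b : Tor (fine (L ^ k) M) × Fin (d + 1) => blockOf (L ^ k) M b.1) ι))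
      (BlockNorm.ofBlocks (unitTorusGeo L k M) (liftBlk (fun b : Tor M × Fin (d + 1) => b.1) ι))
      (qvCov M (L ^ m * L ^ k) T' ∘ₗ pull (liftMap (kingPrV L k m M) ι) - qvCov M (L ^ k) T)
      (fun y y' => (φ + 2 * (1 + K) / (L ^ k : ℕ)) * Real.exp δ * Real.exp (-(δ * tdistT M y y'))) := by
    rw [qvCov, qvCov]
    exact hasMaj_qvKer_twoGrid M k m (by positivity) hφ hδ.le (fun p s hs i => by rw [← h1K]; exact rows_cvaPath_le M (L ^ k) hρ hTr p hs i) hfit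
  have hD4 : HasMaj (BlockNorm.ofBlocks (unitTorusGeo L k M) (liftBlk (fun b : Tor M × Fin (d + 1) => b.1) ι))
      (BlockNorm.ofBlocks (unitTorusGeo L k M) (liftBlk (fun b : Tor (fine (L ^ m * L ^ k) M) × Fin (d + 1) => blockOf (L ^ m * L ^ k) M b.1) ι))
      (qvCovAdj M (L ^ m * L ^ k) T' - pull (liftMap (kingPrV L k m M) ι) ∘ₗ qvCovAdj M (L ^ k) T)
      (fun y y' => (φ + 2 * (1 + K) / (L ^ k : ℕ)) * Real.exp (2 * δ) * Real.exp (-(2 * δ * tdistT M y y'))) := by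
    rw [qvCovAdj, qvCovAdj]
    exact hasMaj_qvAdjKer_twoGrid M k m (by positivity) hφ h2δ (fun p s hs c' => by rw [← h1K]; exact cols_cvaPath_le M (L ^ k) hρ hTc p hs c') hfitA
  have hQ1 : HasMaj (BlockNorm.ofBlocks (unitTorusGeo L k M) (liftBlk (fun b : Tor (fine (L ^ k) M) × Fin (d + 1) => blockOf (L ^ k) M b.1) ι))
      (BlockNorm.ofBlocks (unitTorusGeo L k M) (liftBlk (fun b : Tor M × Fin (d + 1) => b.1) ι))
      (qvCov M (L ^ k) (fun _ _ => (1 : Matrix ι ι ℝ))) (fun y y' => 1 * Real.exp δ * Real.exp (-(δ * tdistT M y y'))) := by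
    have h := hasMaj_qvCov (L := L) M k (L ^ k) (T := fun _ _ => (1 : Matrix ι ι ℝ)) (ρ := 0) le_rfl hδ.le (fun μ p i => by simp)
    simpa only [add_zero, one_pow] using h
  have hQ1' : HasMaj (BlockNorm.ofBlocks (unitTorusGeo L k M) (liftBlk (fun b : Tor M × Fin (d + 1) => b.1) ι))
      (BlockNorm.ofBlocks (unitTorusGeo L k M) (liftBlk (fun b : Tor (fine (L ^ m * L ^ k) M) × Fin (d + 1) => blockOf (L ^ m * L ^ k) M b.1) ι))
      (qvCovAdj M (L ^ m * L ^ k) (fun _ _ => (1 : Matrix ι ι ℝ))) (fun y y' => 1 * Real.exp (2 * δ) * Real.exp (-(2 * δ * tdistT M y y'))) := by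
    have h := hasMaj_qvCovAdj (L := L) M k (L ^ m * L ^ k) (T := fun _ _ => (1 : Matrix ι ι ℝ)) (ρ := 0) le_rfl h2δ (fun μ p j => by simp)
    simpa only [add_zero, one_pow] using h
  have hQT : HasMaj (BlockNorm.ofBlocks (unitTorusGeo L k M) (liftBlk (fun b : Tor (fine (L ^ k) M) × Fin (d + 1) => blockOf (L ^ k) M b.1) ι))
      (BlockNorm.ofBlocks (unitTorusGeo L k M) (liftBlk (fun b : Tor M × Fin (d + 1) => b.1) ι))
      (qvCov M (L ^ k) T) (fun y y' => (1 + K) * Real.exp δ * Real.exp (-(δ * tdistT M y y'))) := by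
    have h := hasMaj_qvCov (L := L) M k (L ^ k) (T := T) hρ hδ.le hTr
    rwa [h1K] at h
  have hQT' : HasMaj (BlockNorm.ofBlocks (unitTorusGeo L k M) (liftBlk (fun b : Tor M × Fin (d + 1) => b.1) ι))
      (BlockNorm.ofBlocks (unitTorusGeo L k M) (liftBlk (fun b : Tor (fine (L ^ m * L ^ k) M) × Fin (d + 1) => blockOf (L ^ m * L ^ k) M b.1) ι))
      (qvCovAdj M (L ^ m * L ^ k) T') (fun y y' => (1 + K') * Real.exp (2 * δ) * Real.exp (-(2 * δ * tdistT M y y'))) := by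
    have h := hasMaj_qvCovAdj (L := L) M k (L ^ m * L ^ k) (T := T') hρ₁ h2δ hTc'
    rwa [h1K'] at h
  -- the four compositions through the unit lattice
  have hW1 := hasMaj_comp_exp (ρ₁ := 2 * δ) (ρ₂ := δ) (ρ := δ) (σ := δ) (triangle254_unitTorusGeo L k M) (unitTorusGeo_dist_nonneg L k M) hrow
    (by positivity) (mul_nonneg hn0 (Real.exp_nonneg _)) hδ.le le_rfl (by linarith) hQ1' hD1
  have hW2 := hasMaj_comp_exp (ρ₁ := 2 * δ) (ρ₂ := δ) (ρ := δ) (σ := δ) (triangle254_unitTorusGeo L k M) (unitTorusGeo_dist_nonneg L k M) hrow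
    (mul_nonneg hn0 (Real.exp_nonneg _)) (by positivity) hδ.le le_rfl (by linarith) hD2 hQ1
  have hW3 := hasMaj_comp_exp (ρ₁ := 2 * δ) (ρ₂ := δ) (ρ := δ) (σ := δ) (triangle254_unitTorusGeo L k M) (unitTorusGeo_dist_nonneg L k M) hrow
    (mul_nonneg (by linarith) (Real.exp_nonneg _)) (mul_nonneg hB (Real.exp_nonneg _)) hδ.le le_rfl (by linarith) hQT' hD3
  have hW4 := hasMaj_comp_exp (ρ₁ := 2 * δ) (ρ₂ := δ) (ρ := δ) (σ := δ) (triangle254_unitTorusGeo L k M) (unitTorusGeo_dist_nonneg L k M) hrow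
    (mul_nonneg hB (Real.exp_nonneg _)) (mul_nonneg (by linarith) (Real.exp_nonneg _)) hδ.le le_rfl (by linarith) hD4 hQT
  have hκ : (BlockNorm.ofBlocks (unitTorusGeo L k M) (liftBlk (fun b : Tor M × Fin (d + 1) => b.1) ι)).κ = 1 := rfl
  refine (hasMaj_smul_ofBlocks _ (fun y y' => ?_) a ((hW1.add hW2).sub (hW3.add hW4))).mono fun y y' => ?_
  · rw [hκ]
    positivity
  · rw [hκ]
    have he : Real.exp (3 * δ) = Real.exp (2 * δ) * Real.exp δ := by rw [← Real.exp_add]; ring_nf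
    rw [he, h1K]
    apply le_of_eq
    simp only [one_mul]
    ring

end Defect

end Summit.QuantumFields.YangMills.BalabanUVNodes.N15.CovAvg

end
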